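import Mathlib
import Summits.QuantumFields.BalabanUV.Beta.DecouplingHolomorphy110
import Summits.QuantumFields.BalabanUV.Beta.DecouplingSupportFixedPoint110
import Literature.MathematicalPhysics.QuantumFieldTheory.Balaban1983to89.B13Contraction113

/-!
# [Balaban1988RG2Cluster] p. 5 ∕ p. 6: «hence the fixed point is an analytic function of A′, s(Y₀)» ∕ «𝐇_k(s(Y₀), B′))
# is an analytic function of s(Y₀)» — the decoupling-coordinate holomorphy of the FIXED POINTS `D(H(s), ·)`, `𝐀₀(s)`
# of (1.3)–(1.4) and of LEMMA 1's TERM, DERIVED in the abstract model from the contraction scheme already in the tree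
# (`B13Contraction113.differentiableOn_fixedPoint`): dictionary item (d3) COMPOSED for Lemma 1's term
# (cell topic `Summits/QuantumFields/BalabanUV/Beta`; row-D4 terminal leaf (T4)(b), census §10.12.2)

HONEST FRAMING (cell rule).  Discharging `BetaPertH` makes Bałaban's UV stability UNCONDITIONAL — a real
constructive-QFT result; NOT the continuum limit, NOT the Clay problem.  This module discharges NOTHING of `BetaPertH`.
The sibling `DecouplingHolomorphy110` derived the polydisc analyticity (the hypothesis `SepHolNear` of
`DecouplingExpansion19.eq_sum_term19_connected`, (1.8) = (1.10)) for the decorated PROPAGATORS and the polynomial term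
shapes.  Lemma 1's term `E(□₀, (tζ̃_□ + t_□ζ_□)𝐇_k(s))`, `𝐇_k(s) = H₀(s)B′ + 𝐀₀(s) − H(s)D(s)` ((1.2)∕(1.17)), contains
in addition the SOLUTIONS of the fixed-point equations (1.3), (1.4) with decorated propagators, of which print says
(p. 5, after (1.13)) *"hence the fixed point is an analytic function of A′, s(Y₀)"* and (p. 6, (1.15)–(1.16)) *"It
implies that the fixed point, i.e. the solution of Eq. (1.4), is an analytic function of B′, s(Y₀)"*.  The tree holds
that sentence as a one-complex-parameter theorem (`B13Contraction113.differentiableOn_fixedPoint`, unit b13-g5: a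
uniformly contracting family of self-maps of a closed ball preserving analytic families has a holomorphic fixed-point
map).  This module applies it ONE DECOUPLING COORDINATE AT A TIME to decorated self-maps of the (finite-volume) field
space and composes the result with the siblings' vocabulary (`map13`, `map14`, `bHk` of `DecouplingSupportFixedPoint110`;
`FieldHol`, `KernelHol`, `sepHolNear_comp` of `DecouplingHolomorphy110`) into `SepHolNear` for Lemma 1's term.  NOT
summit progress.  Unit `b2b-balaban-beta-an4-g35` (owner of `BINDER-OWNERS.md` row D4); cell `GAPS.md` C-an4-74.

CITATION HEADER (lean-in-tree rule).  [II] = T. Bałaban, *Renormalization group approach to lattice gauge field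
theories. II. Cluster expansions*, Commun. Math. Phys. **116**, 1–22 (1988) [Balaban1988RG2Cluster] (journal page =
PDF page; renders `HOME/b2b-balaban-ref1/pages/1988-cmp116-rg-II-cluster/…-p002-x2.png`, `…-p005-x2.png`,
`…-p006-x2.png`, READ AS IMAGES by this unit); [15] = T. Bałaban, *The variational problem and background fields in
renormalization group method for lattice gauge theories*, Commun. Math. Phys. **102**, 277–309 (1985)
[Balaban1985Variational], p. 286 (render `…/1985-cmp102-variational-background-p010-x2.png`).  WHAT IS REPRODUCED —
[II] p. 2: (1.2) `𝐇_k(B′) = H₀B′ + 𝐀₀ − HD(H₀B′ + 𝐀₀)`, (1.3) `D(A′) = C(A′ − HD(A′))`, (1.4) `𝐀₀ + G̃((δ∕δA′)V)(H₀B′ +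
𝐀₀) = 0`, *"Thus Eqs. (1.3), (1.4) are determined by local, analytic functions, and nonlocal propagators H, H₀, G̃."*;
p. 5 [PDF 5], verbatim: *"Thus the transformation defined by the function on the left-hand side of (1.13) maps the
domain {X : |X| < 4C₂ε₂²} into itself. We prove similarly that it is contractive on this domain, hence the fixed point
is an analytic function of A′, s(Y₀), bounded by 4C₂ε₂²."*; [15] p. 286, verbatim: *"This solution is a limit of
uniformly convergent sequence of successive approximations and it is an analytic function of A′."*; [II] p. 6 [PDF 6]:
*"It implies that the fixed point, i.e. the solution of Eq. (1.4), is an analytic function of B′, s(Y₀) on the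
considered domains"*, and after (1.20): *"𝐇_k(s(Y₀), B′)) is an analytic function of s(Y₀), B, for |s(Y₀)| ≦ e^{κ₁}
and g_k|B| < ε₁"*.

WHAT IS CERTIFIED HERE (kernel, sorry-free; [folklore]).
§1 `DecorHolFun U σ₀ S Ψ` ∕ `DecorHol U σ₀ S T` — a decorated (possibly nonlinear) functional `Ψ(s, ·)` ∕ self-map
   `T(s)` of fields PRESERVES coordinate-holomorphic `S`-valued families (the honest rendering of «local, analytic
   functions» composed with analytic propagators; `decorHolFun_of_differentiableOn` = the undecorated case,
   **`sepHolNear_decorComp`** = the decorated chain rule);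
   `UniformContraction U r q T` (self-map of the closed ball of radius `r` with Lipschitz constant `q` at every point
   of the polydomain — «maps the domain … into itself … contractive»); **`fieldHol_of_fixedPoint`**: a family of fixed
   points IN THE BALL of a uniformly contracting (`q < 1`) decorated map preserving holomorphic ball-valued families is
   COORDINATE-HOLOMORPHIC (`B13Contraction113.differentiableOn_fixedPoint` + uniqueness, one coordinate at a time).
§2 The two maps of [II]: **`decorHol_map13`** (the map `X ↦ C(A′(s) − H(s)X)` of (1.3) preserves holomorphic families
   when `C` is holomorphic on a region containing the arguments, `H(s)` is a coordinate-holomorphic kernel and `A′(s)` a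
   coordinate-holomorphic field), **`decorHol_map14`** (the map `A ↦ −G̃(s)·((δ∕δA′)V)(s, H₀(s)B′ + A)` of (1.4), from
   coordinate-holomorphic `G̃(s)`, `H₀(s)` and a decorated gradient preserving holomorphic families);
   **`uniformContraction_map13`** — the self-map and contraction data of (1.3) LITERALLY from the tree's (1.13) scheme
   (`B13Contraction113.mapsTo_T` ∕ `lipschitz_T`: `QuadAnalytic C C₂ R`, `‖H(s)‖ ≤ b`, `|A′(s)| < ε`, `9C₂bε < 1`,
   `3ε ≤ R` ⟹ radius `4C₂ε²`, constant `9C₂bε`); **`uniformContraction_map14`** — the same for (1.4) by the tree's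
   (1.15) substitution `(C₂, b, ε, H) ↦ (C₄b, 1, bε₃, −id)` (`B13Contraction113.fixedPoint_115`): `W(s) :=
   −G̃(s)·((δ∕δA′)V)(s, ·)` of quadratic constant `C₄b`, `‖H₀(s)B′‖ ≤ b·nB`, `nB < ε₃`, `9C₄b²ε₃ < 1`, `3bε₃ ≤ R` ⟹
   radius `4C₄b³ε₃²`, constant `9C₄b²ε₃`.
§3 ENDs: **`sepHolNear_T7dec`** (print's DECORATED example `V_□(σ(Y), H₁(σ(Y))B′)` of (1.38) — the sibling's
   `sepHolNear_T7loc` is the undecorated case), **`fieldHol_bHk`** (`𝐇_k(s)` is coordinate-holomorphic), **`sepHolNear_lemma1Term`** (Lemma 1's term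
   `E(□₀, ζ • 𝐇_k(s))` is `SepHolNear` for `E(□₀, ·)` holomorphic on a region containing the fields), and the assembled
   **`sepHolNear_lemma1Term_of_contractions`**: from coordinate-holomorphic `H₀(s)`, `H(s)`, `G̃(s)` (for walk sums:
   the sibling's `kernelHol_walkSum` ∕ `kernelHol_walkTsum`), holomorphic `C`, `(δ∕δA′)V`, `E(□₀, ·)`, and the
   contraction data of (1.4) and (1.3) on the polydomain with the solutions `𝐀₀(s)`, `D(s)` in their balls ⟹
   `SepHolNear` of Lemma 1's term — so that (1.8) = (1.10) (`DecouplingExpansion19.eq_sum_term19_connected`) applies to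
   it with the support from `DecouplingSupportFixedPoint110.supportedOnRootComp_lemma1Term`, BY NAME.

NOT CLAIMED (located, by name).  Existence of the fixed points (produced, if wanted, by `B13Contraction113.
exists_unique_fixedPoint` ∕ `analytic_fixedPoint_113` per parameter; here they are GIVEN families solving the equations
in the balls — exactly what (1.13)–(1.16) assert); the holomorphy of Bałaban's `C` and `(δ∕δA′)V` ([15] Sect. C,
(80); [II] p. 2 «local, analytic functions» — HYPOTHESES `DifferentiableOn ℂ C S`, `DecorHol … Vg`); the quadratic
bounds of `C` and of `G̃(s)·((δ∕δA′)V)(s, ·)` ([15] Prop. 4∕7, (98) — HYPOTHESES `QuadAnalytic`, as in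
`B13Contraction113`) and the arithmetic of (1.13)–(1.21) (`B13Sect1Arith`); block-locality and support (the siblings);
joint analyticity in several coordinates; every BOUND; NOT summit progress.  MODEL CONVENTIONS: field space `Λ → M` with
the sup norm (finite `Λ`, complete `M`), closed balls centred at `0` as in `B13Contraction113`; hypotheses quantify over
the polydomain `U^{Pt d}` (`InPoly U`), `U` open.
-/

namespace Summit.QuantumFields.BalabanUV.Beta.DecouplingHolomorphyFixedPoint110

open Literature.MathematicalPhysics.QuantumFieldTheory.Balaban1983to89.B14DomainGeom (Pt)
open Literature.MathematicalPhysics.QuantumFieldTheory.Balaban1983to89.B13Contraction113 (QuadAnalytic mapsTo_T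
  lipschitz_T differentiableOn_fixedPoint)
open Summit.QuantumFields.BalabanUV.Beta.DecouplingExpansion19 (SepHolNear)
open Summit.QuantumFields.BalabanUV.Beta.DecouplingSupport110 (kapply)
open Summit.QuantumFields.BalabanUV.Beta.DecouplingSupportFixedPoint110 (bHk map13 map14)
open Summit.QuantumFields.BalabanUV.Beta.DecouplingHolomorphy110 (InPoly FieldHol KernelHol fieldHol_kapply
  fieldHol_const sepHolNear_comp)
open Metric Set

noncomputable section

variable {d : ℕ} {Λ : Type*} [Fintype Λ] {M : Type*} [NormedAddCommGroup M] [NormedSpace ℂ M]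
  {N : Type*} [NormedAddCommGroup N] [NormedSpace ℂ N]

/-! ## §1 Decorated maps preserving holomorphic families; fixed points are coordinate-holomorphic -/

/-- A DECORATED FUNCTIONAL `Ψ(s, ·)` of the field (values in `N`) PRESERVES coordinate-holomorphic `S`-valued families:
in each decoupling coordinate `i ∈ σ₀`, at every base point of the polydomain, `z ↦ Ψ(s|_{s(i)=z}, g(z))` is
holomorphic on `U` whenever `g` is holomorphic on `U` with values in `S` — the joint chain rule print uses for its
DECORATED local functionals, e.g. `V_□(σ(Y), H₁(σ(Y))B′)` of (1.38) and `V(H(s(Y₀)), A′)` of p. 5 (*"is an analytic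
function of A′, s(Y₀)"*). [cite: Balaban1988RG2Cluster, (1.38) p.10] -/
def DecorHolFun (U : Set ℂ) (σ₀ : Finset (Pt d)) (S : Set (Λ → M)) (Ψ : (Pt d → ℂ) → (Λ → M) → N) : Prop :=
  ∀ i ∈ σ₀, ∀ τ : Pt d → ℂ, InPoly U τ → ∀ g : ℂ → (Λ → M), DifferentiableOn ℂ g U → MapsTo g U S →
    DifferentiableOn ℂ (fun z => Ψ (Function.update τ i z) (g z)) U

/-- A DECORATED MAP `T(s) : fields → fields` PRESERVES coordinate-holomorphic `S`-valued families (`DecorHolFun` with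
values in the field space; the rendering of [II] p. 2 «local, analytic functions» ∕ [15] p. 286 «analytic function of
A′» composed with analytic propagators). [cite: Balaban1988RG2Cluster, p.2 after (1.5)] -/
def DecorHol (U : Set ℂ) (σ₀ : Finset (Pt d)) (S : Set (Λ → M)) (T : (Pt d → ℂ) → (Λ → M) → (Λ → M)) : Prop :=
  DecorHolFun U σ₀ S T

/-- An UNDECORATED functional holomorphic on a region `S` preserves holomorphic `S`-valued families (chain rule).
[folklore] -/
theorem decorHolFun_of_differentiableOn {U : Set ℂ} (σ₀ : Finset (Pt d)) {S : Set (Λ → M)} {Ψ : (Λ → M) → N}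
    (hΨ : DifferentiableOn ℂ Ψ S) :
    DecorHolFun U σ₀ S (fun _ : Pt d → ℂ => Ψ) :=
  fun _ _ _ _ _ hg hgS => hΨ.comp hg hgS

omit [Fintype Λ] in
/-- **DECORATED CHAIN RULE**: a decorated functional preserving holomorphic `S`-valued families, evaluated on a
coordinate-holomorphic `S`-valued field, is separately holomorphic. [folklore] -/
theorem sepHolNear_decorComp {U : Set ℂ} {σ₀ : Finset (Pt d)} {S : Set (Λ → M)} {Ψ : (Pt d → ℂ) → (Λ → M) → N}
    (hΨ : DecorHolFun U σ₀ S Ψ) {f : (Pt d → ℂ) → Λ → M} (hf : FieldHol U σ₀ f) (hS : ∀ τ, InPoly U τ → f τ ∈ S) :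
    SepHolNear (fun τ => Ψ τ (f τ)) σ₀ U :=
  fun i hi τ hτ => hΨ i hi τ hτ _ (differentiableOn_pi.2 fun x => hf x i hi τ hτ) fun _ hz => hS _ (InPoly.update hτ i hz)

/-- UNIFORM CONTRACTION DATA on the polydomain: at every parameter vector with coordinates in `U`, `T(s)` maps the closed
ball of radius `r` into itself and is `q`-Lipschitz there ([II] p. 5 «maps the domain … into itself … it is
contractive on this domain»). [cite: Balaban1988RG2Cluster, p.5 after (1.13)] -/
structure UniformContraction (U : Set ℂ) (r q : ℝ) (T : (Pt d → ℂ) → (Λ → M) → (Λ → M)) : Prop where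
  mapsTo : ∀ τ : Pt d → ℂ, InPoly U τ → MapsTo (T τ) (closedBall 0 r) (closedBall 0 r)
  lipschitz : ∀ τ : Pt d → ℂ, InPoly U τ → ∀ X ∈ closedBall (0 : Λ → M) r, ∀ X' ∈ closedBall (0 : Λ → M) r,
    ‖T τ X - T τ X'‖ ≤ q * ‖X - X'‖

omit [NormedSpace ℂ M] in
/-- Uniqueness of the fixed point in the ball under a contraction constant `q < 1`. [folklore] -/
theorem UniformContraction.unique {U : Set ℂ} {r q : ℝ} {T : (Pt d → ℂ) → (Λ → M) → (Λ → M)}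
    (hT : UniformContraction U r q T) (hq : q < 1) {τ : Pt d → ℂ} (hτ : InPoly U τ) {X X' : Λ → M}
    (hX : X ∈ closedBall (0 : Λ → M) r) (hX' : X' ∈ closedBall (0 : Λ → M) r) (hfX : T τ X = X)
    (hfX' : T τ X' = X') : X = X' := by
  have h := hT.lipschitz τ hτ X hX X' hX'
  rw [hfX, hfX'] at h
  have h0 : (1 - q) * ‖X - X'‖ ≤ (1 - q) * 0 := by nlinarith [norm_nonneg (X - X')]
  have h1 : ‖X - X'‖ ≤ 0 := le_of_mul_le_mul_left h0 (by linarith)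
  exact sub_eq_zero.1 (norm_le_zero_iff.1 h1)

/-- **FIXED POINTS OF UNIFORMLY CONTRACTING DECORATED MAPS ARE COORDINATE-HOLOMORPHIC** — [II] p. 5 *"hence the fixed
point is an analytic function of A′, s(Y₀)"* ∕ [15] p. 286 *"This solution is a limit of uniformly convergent sequence
of successive approximations and it is an analytic function"*, one decoupling coordinate at a time: if `T(s)` contracts
the closed `r`-ball uniformly on the polydomain (`q < 1`) and preserves holomorphic ball-valued families, then any family
`fix(s)` of solutions of `T(s)(fix(s)) = fix(s)` lying in the ball is coordinate-holomorphic (the tree's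
`B13Contraction113.differentiableOn_fixedPoint` supplies a holomorphic fixed-point map per coordinate; uniqueness
identifies it with `fix`). [cite: Balaban1988RG2Cluster, p.5 after (1.13)] [cite: Balaban1985Variational, p.286 after (54)] -/
theorem fieldHol_of_fixedPoint [CompleteSpace M] {U : Set ℂ} (hU : IsOpen U) {σ₀ : Finset (Pt d)} {r q : ℝ}
    (hr : 0 ≤ r) (hq0 : 0 ≤ q) (hq : q < 1) {T : (Pt d → ℂ) → (Λ → M) → (Λ → M)}
    (hT : UniformContraction U r q T) (hhol : DecorHol U σ₀ (closedBall 0 r) T) {fix : (Pt d → ℂ) → Λ → M}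
    (hmem : ∀ τ, InPoly U τ → fix τ ∈ closedBall (0 : Λ → M) r) (hfix : ∀ τ, InPoly U τ → T τ (fix τ) = fix τ) :
    FieldHol U σ₀ fix := by
  intro x i hi τ hτ
  obtain ⟨Xs, hXs, hfx, -⟩ := differentiableOn_fixedPoint (T := fun z X => T (Function.update τ i z) X) hU hr hq0 hq
    (fun z hz => hT.mapsTo _ (InPoly.update hτ i hz)) (fun z hz => hT.lipschitz _ (InPoly.update hτ i hz)) (hhol i hi τ hτ)
  have heq : ∀ z ∈ U, fix (Function.update τ i z) = Xs z := fun z hz =>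
    hT.unique hq (InPoly.update hτ i hz) (hmem _ (InPoly.update hτ i hz)) (hfx z hz).1 (hfix _ (InPoly.update hτ i hz)) (hfx z hz).2
  exact ((differentiableOn_pi.1 hXs) x).congr fun z hz => by simp only [heq z hz]

/-! ## §2 The maps of (1.3) and (1.4) with decorated propagators -/

variable {𝔸 : Type*} [NormedRing 𝔸] [NormedAlgebra ℂ 𝔸] [Module 𝔸 M] [IsBoundedSMul 𝔸 M] [IsScalarTower ℂ 𝔸 M]

/-- A coordinate-holomorphic kernel applied to a holomorphic curve of fields is a holomorphic curve of fields. [folklore] -/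
theorem differentiableOn_kapply_update {U : Set ℂ} {σ₀ : Finset (Pt d)} {K : (Pt d → ℂ) → Λ → Λ → 𝔸}
    (hK : KernelHol U σ₀ K) {i : Pt d} (hi : i ∈ σ₀) {τ : Pt d → ℂ} (hτ : InPoly U τ) {g : ℂ → (Λ → M)}
    (hg : DifferentiableOn ℂ g U) :
    DifferentiableOn ℂ (fun z => kapply (K (Function.update τ i z)) (g z)) U := by
  refine differentiableOn_pi.2 fun x => ?_
  unfold kapply
  exact DifferentiableOn.fun_sum fun y _ => (hK x y i hi τ hτ).smul ((differentiableOn_pi.1 hg) y)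

/-- **THE MAP OF (1.3) PRESERVES HOLOMORPHIC FAMILIES**: `X ↦ C(A′(s) − H(s)X)` with `C` holomorphic on a region `S`
containing the arguments `A′(s) − H(s)X`, `X` in the `r`-ball ([II] p. 2 «local, analytic functions»), `H(s)` a
coordinate-holomorphic kernel, `A′(s) = H₀(s)B′ + 𝐀₀(s)` with `H₀(s)`, `𝐀₀(s)` coordinate-holomorphic.
[cite: Balaban1988RG2Cluster, (1.3) p.2] -/
theorem decorHol_map13 {U : Set ℂ} {σ₀ : Finset (Pt d)} {r : ℝ} {H₀ H : (Pt d → ℂ) → Λ → Λ → 𝔸}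
    (hH₀ : KernelHol U σ₀ H₀) (hH : KernelHol U σ₀ H) (Bp : Λ → M) {C : (Λ → M) → (Λ → M)} {S : Set (Λ → M)}
    (hC : DifferentiableOn ℂ C S) {A₀ : (Pt d → ℂ) → Λ → M} (hA₀ : FieldHol U σ₀ A₀)
    (hS : ∀ τ, InPoly U τ → ∀ X ∈ closedBall (0 : Λ → M) r,
      (fun x => (kapply (H₀ τ) Bp x + A₀ τ x) - kapply (H τ) X x) ∈ S) :
    DecorHol U σ₀ (closedBall 0 r) (map13 H₀ H Bp C A₀) := by
  intro i hi τ hτ g hg hgS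
  unfold map13
  refine hC.comp ?_ fun z hz => hS _ (InPoly.update hτ i hz) _ (hgS hz)
  refine differentiableOn_pi.2 fun x => ?_
  have hAp : DifferentiableOn ℂ (fun z => kapply (H₀ (Function.update τ i z)) Bp x + A₀ (Function.update τ i z) x) U :=
    (fieldHol_kapply hH₀ (fieldHol_const U σ₀ Bp) x i hi τ hτ).add (hA₀ x i hi τ hτ)
  exact hAp.sub ((differentiableOn_pi.1 (differentiableOn_kapply_update hH hi hτ hg)) x)

/-- **THE MAP OF (1.4) PRESERVES HOLOMORPHIC FAMILIES**: `A ↦ −G̃(s)·((δ∕δA′)V)(s, H₀(s)B′ + A)` with `G̃(s)`, `H₀(s)`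
coordinate-holomorphic kernels and the decorated gradient `(δ∕δA′)V(H(s), ·)` preserving holomorphic `S′`-valued
families, `S′` containing the arguments `H₀(s)B′ + A`, `A` in the `r`-ball ([II] p. 4 «has similar properties»).
[cite: Balaban1988RG2Cluster, (1.4) p.2] -/
theorem decorHol_map14 {U : Set ℂ} {σ₀ : Finset (Pt d)} {r : ℝ} {Gt H₀ : (Pt d → ℂ) → Λ → Λ → 𝔸}
    (hGt : KernelHol U σ₀ Gt) (hH₀ : KernelHol U σ₀ H₀) (Bp : Λ → M) {Vg : (Pt d → ℂ) → (Λ → M) → (Λ → M)}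
    {S' : Set (Λ → M)} (hVg : DecorHol U σ₀ S' Vg)
    (hS' : ∀ τ, InPoly U τ → ∀ A ∈ closedBall (0 : Λ → M) r, (fun y => kapply (H₀ τ) Bp y + A y) ∈ S') :
    DecorHol U σ₀ (closedBall 0 r) (map14 Gt H₀ Bp Vg) := by
  intro i hi τ hτ g hg hgS
  unfold map14
  have harg : DifferentiableOn ℂ (fun z => fun y => kapply (H₀ (Function.update τ i z)) Bp y + g z y) U :=
    differentiableOn_pi.2 fun y =>
      (fieldHol_kapply hH₀ (fieldHol_const U σ₀ Bp) y i hi τ hτ).add ((differentiableOn_pi.1 hg) y)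
  have hV : DifferentiableOn ℂ (fun z => Vg (Function.update τ i z)
      (fun y => kapply (H₀ (Function.update τ i z)) Bp y + g z y)) U :=
    hVg i hi τ hτ _ harg fun z hz => hS' _ (InPoly.update hτ i hz) _ (hgS hz)
  refine differentiableOn_pi.2 fun x => ?_
  exact ((differentiableOn_pi.1 (differentiableOn_kapply_update hGt hi hτ hV)) x).neg

/-- The kernel action as a `ℂ`-LINEAR map of the field space (the `H` of `B13Contraction113`'s scheme). [folklore] -/
def kapplyLin (K : Λ → Λ → 𝔸) : (Λ → M) →ₗ[ℂ] (Λ → M) where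
  toFun := kapply K
  map_add' v w := by
    ext x; simp only [kapply, Pi.add_apply, smul_add, Finset.sum_add_distrib]
  map_smul' c v := by
    ext x; simp only [kapply, Pi.smul_apply, RingHom.id_apply, Finset.smul_sum, smul_comm c]

omit [IsBoundedSMul 𝔸 M] in
/-- `kapplyLin K X = kapply K X`. [folklore] -/
@[simp] theorem kapplyLin_apply (K : Λ → Λ → 𝔸) (X : Λ → M) : kapplyLin (M := M) K X = kapply K X := rfl

omit [IsBoundedSMul 𝔸 M] in
/-- The map of (1.3) IS the transformation `X ↦ C(A′ − H X)` of `B13Contraction113` with `H = kapplyLin (H(s))`,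
`A′ = H₀(s)B′ + 𝐀₀(s)`. [folklore] -/
theorem map13_eq (H₀ H : (Pt d → ℂ) → Λ → Λ → 𝔸) (Bp : Λ → M) (C : (Λ → M) → (Λ → M)) (A₀ : (Pt d → ℂ) → Λ → M)
    (τ : Pt d → ℂ) (X : Λ → M) :
    map13 H₀ H Bp C A₀ τ X = C ((fun x => kapply (H₀ τ) Bp x + A₀ τ x) - kapplyLin (M := M) (H τ) X) := rfl

omit [IsBoundedSMul 𝔸 M] in
/-- **THE CONTRACTION DATA OF (1.3) FROM THE TREE'S (1.13) SCHEME, LITERALLY**: `QuadAnalytic C C₂ R` (quadratic bound +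
line analyticity of `C`, [15] Prop. 4∕7), `‖H(s)X‖ ≤ b‖X‖` and `|A′(s)| < ε` on the polydomain, `9C₂bε < 1`, `3ε ≤ R`
⟹ the map of (1.3) contracts the closed ball of radius `4C₂ε²` with constant `9C₂bε` UNIFORMLY on the polydomain
(`B13Contraction113.mapsTo_T`, `.lipschitz_T`). [cite: Balaban1988RG2Cluster, (1.13) p.5] -/
theorem uniformContraction_map13 {U : Set ℂ} {C : (Λ → M) → (Λ → M)} {C₂ R b ε : ℝ} (hC : QuadAnalytic C C₂ R)
    (hC₂ : 0 ≤ C₂) (hb : 0 ≤ b) {H₀ H : (Pt d → ℂ) → Λ → Λ → 𝔸} (Bp : Λ → M) {A₀ : (Pt d → ℂ) → Λ → M}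
    (hH : ∀ τ, InPoly U τ → ∀ X : Λ → M, ‖kapply (H τ) X‖ ≤ b * ‖X‖)
    (hA : ∀ τ, InPoly U τ → ‖(fun x => kapply (H₀ τ) Bp x + A₀ τ x)‖ < ε) (hq : 9 * C₂ * b * ε < 1)
    (hRC : 3 * ε ≤ R) :
    UniformContraction U (4 * C₂ * ε ^ 2) (9 * C₂ * b * ε) (map13 H₀ H Bp C A₀) := by
  have key : ∀ τ, InPoly U τ → 0 < ε ∧ 4 * C₂ * b * ε ≤ 1 := fun τ hτ => by
    have hε : 0 < ε := (norm_nonneg _).trans_lt (hA τ hτ)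
    exact ⟨hε, by nlinarith [mul_nonneg (mul_nonneg (mul_nonneg (by norm_num : (0:ℝ) ≤ 4) hC₂) hb) hε.le]⟩
  refine ⟨fun τ hτ X hX => ?_, fun τ hτ X hX X' hX' => ?_⟩
  · rw [map13_eq]
    exact mapsTo_T (Hop := kapplyLin (M := M) (H τ)) hC hC₂ hb (hH τ hτ) (hA τ hτ) (key τ hτ).2
      (by linarith [(key τ hτ).1]) hX
  · rw [map13_eq, map13_eq]
    exact lipschitz_T (Hop := kapplyLin (M := M) (H τ)) hC hC₂ hb (hH τ hτ) (hA τ hτ) (key τ hτ).2 hRC hX hX'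

omit [NormedAlgebra ℂ 𝔸] [IsBoundedSMul 𝔸 M] [IsScalarTower ℂ 𝔸 M] in
/-- The map of (1.4) IS the transformation `A ↦ W(A₁ − (−id)A) = W(A₁ + A)` of `B13Contraction113.fixedPoint_115` with
`W(s) := −G̃(s)·((δ∕δA′)V)(s, ·)` and `A₁(s) = H₀(s)B′`. [folklore] -/
theorem map14_eq (Gt H₀ : (Pt d → ℂ) → Λ → Λ → 𝔸) (Bp : Λ → M) (Vg : (Pt d → ℂ) → (Λ → M) → (Λ → M))
    (τ : Pt d → ℂ) (A : Λ → M) :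
    map14 Gt H₀ Bp Vg τ A = (fun Y : Λ → M => fun x => -(kapply (Gt τ) (Vg τ Y) x))
      ((fun y => kapply (H₀ τ) Bp y) - (-LinearMap.id : (Λ → M) →ₗ[ℂ] (Λ → M)) A) := by
  have h : ((fun y => kapply (H₀ τ) Bp y) - (-LinearMap.id : (Λ → M) →ₗ[ℂ] (Λ → M)) A)
      = fun y => kapply (H₀ τ) Bp y + A y := by
    funext y; simp [sub_neg_eq_add]
  rw [h]; rfl

omit [NormedAlgebra ℂ 𝔸] [IsBoundedSMul 𝔸 M] [IsScalarTower ℂ 𝔸 M] in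
/-- **THE CONTRACTION DATA OF (1.4) FROM THE TREE'S (1.15) SCHEME, LITERALLY** ([II] p. 6: the self-map condition
`4C₄B₀²e^{32κ₁}ε₃ ≦ 1` and radius `4C₄(B₀e^{16κ₁})³ε₃²`; `B13Contraction113.fixedPoint_115`'s substitution
`(C₂, b, ε, H) ↦ (C₄b, 1, bε₃, −id)` into `mapsTo_T` ∕ `lipschitz_T`): with `W(s) := −G̃(s)·((δ∕δA′)V)(s, ·)` of
quadratic constant `C₄b` on radius `R` at every point of the polydomain (the rendering of (98) [15] + `‖G̃(s)‖ ≤ b`),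
`‖H₀(s)B′‖ ≤ b·nB`, `nB < ε₃`, `9C₄b²ε₃ < 1`, `3bε₃ ≤ R` ⟹ the map of (1.4) contracts the closed ball of radius
`4C₄b³ε₃²` with constant `9C₄b²ε₃` UNIFORMLY on the polydomain. [cite: Balaban1988RG2Cluster, (1.15)-(1.16) p.6] -/
theorem uniformContraction_map14 {U : Set ℂ} {Gt H₀ : (Pt d → ℂ) → Λ → Λ → 𝔸} (Bp : Λ → M)
    {Vg : (Pt d → ℂ) → (Λ → M) → (Λ → M)} {C₄ R b ε₃ nB : ℝ}
    (hW : ∀ τ, InPoly U τ → QuadAnalytic (fun Y : Λ → M => fun x => -(kapply (Gt τ) (Vg τ Y) x)) (C₄ * b) R)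
    (hC₄ : 0 ≤ C₄) (hb : 0 < b) (hA₁ : ∀ τ, InPoly U τ → ‖(fun y => kapply (H₀ τ) Bp y)‖ ≤ b * nB)
    (hB : nB < ε₃) (hq : 9 * C₄ * b ^ 2 * ε₃ < 1) (hRC : 3 * (b * ε₃) ≤ R) :
    UniformContraction U (4 * C₄ * b ^ 3 * ε₃ ^ 2) (9 * C₄ * b ^ 2 * ε₃) (map14 Gt H₀ Bp Vg) := by
  have hC₂ : 0 ≤ C₄ * b := mul_nonneg hC₄ hb.le
  have hrad : 4 * (C₄ * b) * (b * ε₃) ^ 2 = 4 * C₄ * b ^ 3 * ε₃ ^ 2 := by ring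
  have hlip : 9 * (C₄ * b) * 1 * (b * ε₃) = 9 * C₄ * b ^ 2 * ε₃ := by ring
  have hHop : ∀ X : Λ → M, ‖(-LinearMap.id : (Λ → M) →ₗ[ℂ] (Λ → M)) X‖ ≤ 1 * ‖X‖ := fun X => by simp
  have key : ∀ τ, InPoly U τ → ‖(fun y => kapply (H₀ τ) Bp y)‖ < b * ε₃ ∧ 4 * (C₄ * b) * 1 * (b * ε₃) ≤ 1 ∧
      2 * (b * ε₃) ≤ R := fun τ hτ => by
    have hnB : 0 ≤ nB := le_of_mul_le_mul_left (by simpa using (norm_nonneg _).trans (hA₁ τ hτ)) hb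
    have hε₃ : 0 ≤ b * ε₃ := mul_nonneg hb.le (hnB.trans hB.le)
    refine ⟨(hA₁ τ hτ).trans_lt (mul_lt_mul_of_pos_left hB hb), ?_, by linarith⟩
    nlinarith [mul_nonneg hC₂ hε₃]
  refine ⟨fun τ hτ X hX => ?_, fun τ hτ X hX X' hX' => ?_⟩
  · rw [map14_eq, ← hrad]
    rw [← hrad] at hX
    exact mapsTo_T (Hop := (-LinearMap.id : (Λ → M) →ₗ[ℂ] (Λ → M))) (hW τ hτ) hC₂ zero_le_one hHop (key τ hτ).1
      (key τ hτ).2.1 (key τ hτ).2.2 hX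
  · rw [map14_eq, map14_eq, ← hlip]
    rw [← hrad] at hX hX'
    exact lipschitz_T (Hop := (-LinearMap.id : (Λ → M) →ₗ[ℂ] (Λ → M))) (hW τ hτ) hC₂ zero_le_one hHop (key τ hτ).1
      (key τ hτ).2.1 hRC hX hX'

/-! ## §3 ENDs: the decorated T7, `𝐇_k(s)` and Lemma 1's term -/

/-- **PRINT's DECORATED T7** `V_□(σ(Y), H₁(σ(Y))B′)` ([II] (1.38) p. 10 — the functional `V_□` carries its own
decoration through `H(s)`, `D(H(s), ·)` of (47)∕(80) [15]): separately holomorphic when `V_□(s, ·)` preserves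
holomorphic `S`-valued families and `H₁(s)` is a coordinate-holomorphic kernel (the sibling's `sepHolNear_T7loc` is
the undecorated case `decorHolFun_of_differentiableOn`). [cite: Balaban1988RG2Cluster, (1.38) p.10] -/
theorem sepHolNear_T7dec {U : Set ℂ} {σ₀ : Finset (Pt d)} {Vb : (Pt d → ℂ) → (Λ → M) → N} {S : Set (Λ → M)}
    (hV : DecorHolFun U σ₀ S Vb) {H₁ : (Pt d → ℂ) → Λ → Λ → 𝔸} (hH : KernelHol U σ₀ H₁) (Bp : Λ → M)
    (hS : ∀ τ, InPoly U τ → kapply (H₁ τ) Bp ∈ S) : SepHolNear (fun τ => Vb τ (kapply (H₁ τ) Bp)) σ₀ U :=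
  sepHolNear_decorComp hV (fieldHol_kapply hH (fieldHol_const U σ₀ Bp)) hS

/-- **`𝐇_k(s) = H₀(s)B′ + 𝐀₀(s) − H(s)D(s)` IS COORDINATE-HOLOMORPHIC** when the propagators are coordinate-holomorphic
kernels and the two fixed points are coordinate-holomorphic fields ([II] p. 6 after (1.20)). [cite: Balaban1988RG2Cluster, (1.17) p.6] -/
theorem fieldHol_bHk {U : Set ℂ} {σ₀ : Finset (Pt d)} {H₀ H : (Pt d → ℂ) → Λ → Λ → 𝔸} (hH₀ : KernelHol U σ₀ H₀)
    (hH : KernelHol U σ₀ H) (Bp : Λ → M) {A₀ Dfix : (Pt d → ℂ) → Λ → M} (hA₀ : FieldHol U σ₀ A₀)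
    (hD : FieldHol U σ₀ Dfix) : FieldHol U σ₀ (bHk H₀ H Bp A₀ Dfix) :=
  ((fieldHol_kapply hH₀ (fieldHol_const U σ₀ Bp)).add hA₀).sub (fieldHol_kapply hH hD)

/-- **LEMMA 1's TERM IS SEPARATELY HOLOMORPHIC** — `E(□₀, ζ • 𝐇_k(s))` with `E(□₀, ·)` holomorphic on a region `S` of
field space containing the fields `ζ • 𝐇_k(s)` ([II] p. 2 «analytic … in 𝐀», p. 6 «𝐇_k(s(Y₀), B′)) is an analytic
function of s(Y₀)»): the sibling's hypothesis `SepHolNear` for the term of `supportedOnRootComp_lemma1Term`.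
[cite: Balaban1988RG2Cluster, p.6 after (1.20)] -/
theorem sepHolNear_lemma1Term {U : Set ℂ} {σ₀ : Finset (Pt d)}
    {Ψ : (Λ → M) → N} {S : Set (Λ → M)} (hΨ : DifferentiableOn ℂ Ψ S) (ζ : Λ → ℂ)
    {H₀ H : (Pt d → ℂ) → Λ → Λ → 𝔸} (hH₀ : KernelHol U σ₀ H₀) (hH : KernelHol U σ₀ H) (Bp : Λ → M)
    {A₀ Dfix : (Pt d → ℂ) → Λ → M} (hA₀ : FieldHol U σ₀ A₀) (hD : FieldHol U σ₀ Dfix)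
    (hS : ∀ τ, InPoly U τ → (fun x => ζ x • bHk H₀ H Bp A₀ Dfix τ x) ∈ S) :
    SepHolNear (fun τ => Ψ (fun x => ζ x • bHk H₀ H Bp A₀ Dfix τ x)) σ₀ U :=
  sepHolNear_comp hΨ ((fieldHol_bHk hH₀ hH Bp hA₀ hD).smul_site ζ) hS

/-- **THE ASSEMBLED STATEMENT FOR LEMMA 1's TERM** ([II] pp. 2–6, the analyticity sentences of §1 composed): on the
open polydomain `U^{Pt d}`, if the decorated propagators `H₀(s)`, `H(s)`, `G̃(s)` are coordinate-holomorphic kernels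
(finite walk sums: `DecouplingHolomorphy110.kernelHol_walkSum`; series: `kernelHol_walkTsum`), the gradient
`(δ∕δA′)V(H(s), ·)` preserves holomorphic families on a region containing the arguments, `C` and `E(□₀, ·)` are
holomorphic on regions containing theirs, the maps of (1.4) and (1.3) contract their balls uniformly (`q₄, q₃ < 1`), and
`𝐀₀(s)`, `D(s)` are the solutions in those balls — then Lemma 1's term `E(□₀, ζ • 𝐇_k(s))` is `SepHolNear` on `U`;
with `U ⊇ {|z| ≤ ρ}` and the support (`DecouplingSupportFixedPoint110.supportedOnRootComp_lemma1Term`) the decoupling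
identity (1.8) = (1.10) (`DecouplingExpansion19.eq_sum_term19_connected`) holds for it BY NAME.
[cite: Balaban1988RG2Cluster, p.6 after (1.20)] -/
theorem sepHolNear_lemma1Term_of_contractions [CompleteSpace M] {U : Set ℂ} (hU : IsOpen U) {σ₀ : Finset (Pt d)}
    {Ψ : (Λ → M) → N} {SE : Set (Λ → M)}
    (hΨ : DifferentiableOn ℂ Ψ SE) (ζ : Λ → ℂ) {H₀ H Gt : (Pt d → ℂ) → Λ → Λ → 𝔸} (hH₀ : KernelHol U σ₀ H₀)
    (hH : KernelHol U σ₀ H) (hGt : KernelHol U σ₀ Gt) (Bp : Λ → M)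
    {Vg : (Pt d → ℂ) → (Λ → M) → (Λ → M)} {SV : Set (Λ → M)} (hVg : DecorHol U σ₀ SV Vg)
    {C : (Λ → M) → (Λ → M)} {SC : Set (Λ → M)} (hC : DifferentiableOn ℂ C SC)
    {r₄ q₄ r₃ q₃ : ℝ} (hr₄ : 0 ≤ r₄) (hq₄0 : 0 ≤ q₄) (hq₄ : q₄ < 1) (hr₃ : 0 ≤ r₃) (hq₃0 : 0 ≤ q₃) (hq₃ : q₃ < 1)
    (hT₄ : UniformContraction U r₄ q₄ (map14 Gt H₀ Bp Vg))
    (hSV : ∀ τ, InPoly U τ → ∀ A ∈ closedBall (0 : Λ → M) r₄, (fun y => kapply (H₀ τ) Bp y + A y) ∈ SV)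
    {A₀ : (Pt d → ℂ) → Λ → M} (hA₀m : ∀ τ, InPoly U τ → A₀ τ ∈ closedBall (0 : Λ → M) r₄)
    (hA₀f : ∀ τ, InPoly U τ → map14 Gt H₀ Bp Vg τ (A₀ τ) = A₀ τ)
    (hT₃ : UniformContraction U r₃ q₃ (map13 H₀ H Bp C A₀))
    (hSC : ∀ τ, InPoly U τ → ∀ X ∈ closedBall (0 : Λ → M) r₃,
      (fun x => (kapply (H₀ τ) Bp x + A₀ τ x) - kapply (H τ) X x) ∈ SC)
    {Dfix : (Pt d → ℂ) → Λ → M} (hDm : ∀ τ, InPoly U τ → Dfix τ ∈ closedBall (0 : Λ → M) r₃)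
    (hDf : ∀ τ, InPoly U τ → map13 H₀ H Bp C A₀ τ (Dfix τ) = Dfix τ)
    (hSE : ∀ τ, InPoly U τ → (fun x => ζ x • bHk H₀ H Bp A₀ Dfix τ x) ∈ SE) :
    SepHolNear (fun τ => Ψ (fun x => ζ x • bHk H₀ H Bp A₀ Dfix τ x)) σ₀ U := by
  have hA₀ : FieldHol U σ₀ A₀ :=
    fieldHol_of_fixedPoint hU hr₄ hq₄0 hq₄ hT₄ (decorHol_map14 hGt hH₀ Bp hVg hSV) hA₀m hA₀f
  have hD : FieldHol U σ₀ Dfix :=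
    fieldHol_of_fixedPoint hU hr₃ hq₃0 hq₃ hT₃ (decorHol_map13 hH₀ hH Bp hC hA₀ hSC) hDm hDf
  exact sepHolNear_lemma1Term hΨ ζ hH₀ hH Bp hA₀ hD hSE

end

end Summit.QuantumFields.BalabanUV.Beta.DecouplingHolomorphyFixedPoint110
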